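import Literature.Analysis.FluidPDE.DissipativeMVEuler
import Literature.Analysis.FunctionSpaces.TorusCalculus
import HarnessLib

/-!
# Weak (measure-valued)–strong uniqueness for the complete Euler system (Březina–Feireisl 2018,
# Thm. 3.3) — named fact, in the repaired form asked for by the review of p4170

Topic `Literature/Analysis/FluidPDE` (compressible Euler; sub-namespace `CompressibleEuler` as in
the sibling `DissipativeMVEuler.lean`, which vendors BF Definition 2.9 as
`IsDissipativeMVSolution`). One DEFINITION of a solution notion and one NAMED FACT
(`def … : Prop`, D-0014; nothing is proved or asserted, users take `(h : brezinaFeireisl2018_thm_3_3)`):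

* `IsClassicalEulerSolution eos T ρ u ϑ` — classical (jointly `C^∞` on `[0,T) × 𝕋³`, `ρ, ϑ > 0`)
  solution of the complete Euler system (1.1)–(1.3) for a general equation of state
  `eos : EulerEOS` — literally the sibling `Literature.MathematicalPhysics.KineticTheory.IsHardSphereEulerSolution`
  (HardSphereEuler.lean) with `hsPressure σ` replaced by `eos.p` and the athermal internal energy
  `3ϑ/2` by `eos.e` (so a hard-sphere solution is a classical solution for
  `EulerEOS.monatomicExcess (hsCompressibility (· * σ^3)) (hsExcessFreeEnergy (· * σ^3))` by
  unfolding — the bridge the consuming cruxes need; not proved here);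
* `brezinaFeireisl2018_thm_3_3` — BF Thm. 3.3: a dissipative measure-valued solution on `(0,T)`
  emanating from the (Dirac) data of a classical solution coincides with it and has zero
  dissipation defect.

## What is printed (arXiv:1702.04870 = J. Math. Soc. Japan 70 (2018) 1227–1245; read 2026-08-15)

Thm. 3.3 (journal p. 1243; arXiv p. 12): "Let the thermodynamic functions `e = e(ρ,ϑ)`,
`s = s(ρ,ϑ)`, and `p = p(ρ,ϑ)` satisfy Gibbs' relation (1.5), the hypothesis of thermodynamic
stability (journal (2.19) = arXiv (2.24)), and let `|p(ρ,ϑ)| ≤ c(1 + ρ + ρ|s(ρ,ϑ)| + ρ e(ρ,ϑ))`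
(journal (3.1)). Let `[r, Θ, U]` be a continuously differentiable classical solution of the
Euler system (1.1)–(1.3) in `(0,T) × Ω` starting from the initial data `(r₀, Θ₀, U₀)` satisfying
`r₀ > 0`, `Θ₀ > 0`. Assume that `[Y_{t,x}; 𝒟]` is a dissipative measure valued solution of the
same problem in the sense specified in Definition 2.9 such that
`Y_{0,x} = δ_{[r₀(x), r₀e(r₀,Θ₀)(x), r₀U₀(x)]}` for a.a. `x ∈ Ω`. Then `𝒟 = 0` and
`Y_{t,x} = δ_{[r(t,x), r e(r,Θ)(t,x), r U(t,x)]}` for any `(t,x) ∈ (0,T) × Ω`."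
The strong solution is taken in the class (3.2): `r, Θ ∈ C¹([0,T] × Ω)`, `r, Θ > 0`,
`U ∈ C¹([0,T] × Ω; ℝ³)` (closed interval).

## Why this is not p4170, and how the review's objections are met

The first vendoring (p4170, 2026-08-13, `brezinaFeireisl_mvStrongUniqueness`) was REJECTED as
false as formalised: the tree's Def. 2.9 reads the REAL-valued junk of the conservative entropy
`s(ρ,E)` at `E = 0` (BF use the genuine extension `s = -∞` there, so zero-internal-energy states
carry no mass), and the reviewer built a counter-model (perfect gas, rest state, Young measure
jumping from `δ(1,c_v,0)` to `δ(1,0,0)`, defect `c_v·|Ω| > 0`). This file takes the review's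
repair (b): the fact carries the extra hypothesis that the Young measure is carried by the OPEN
quadrant `{ρ > 0, E > 0}` (field-free: `∀ z, ∀ᵐ w ∂(Y z), 0 < dens w ∧ 0 < ien w`), on which —
with `e > 0` and the temperature inversion bijective, also hypotheses here — `EulerEOS.toConservative`
is literally BF's identification of functions of `(ρ,ϑ)` with functions of `[ρ,E,m]`, so Thm. 3.3
applies verbatim. RELATIVE TO PRINT the fact is therefore WEAKER (never stronger) in five ways,
each recorded so that no consumer mistakes it for the printed theorem: (i) vacuum and
zero-internal-energy states are excluded from the support of `Y`; (ii) `p, e, s` are assumed `C²`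
on the open quadrant (BF's standing smoothness, made explicit; `IsGibbs` already has `C¹`);
(iii) `e > 0` and `ϑ ↦ ρe(ρ,ϑ)` is a bijection of `(0,∞)` inverted by `eos.temperature` (BF §3.2:
"(ρ,ϑ) ↦ [ρ, ρe(ρ,ϑ)] : (0,∞)² → (0,∞)²"); (iv) the strong solution is `C^∞` (not just `C¹`) and
lives on `[0,T₁)` for some `T₁ > T` (so it is smooth on the closed `[0,T]`, as in (3.2)) — this is
the half-open convention of `IsHardSphereEulerSolution`, which makes the hard-sphere bridge an
unfolding; (v) the conclusions are stated almost everywhere — `𝒟 = 0` for a.e. `τ ∈ (0,T)` and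
`Y_{t,x} = δ_{…}` for a.e. `(t,x) ∈ (0,T) × 𝕋³` — because in the tree's model a Young measure is
an honest Markov kernel constrained only through integrals (BF's `Y ∈ L^∞_{w*}` is an a.e.-class,
for which "for any (t,x)" and "a.e." coincide). The initial condition is imposed for a.e. `x`, as
printed. Locators below use the JOURNAL numbering with the arXiv number in brackets where they
differ (review item 2).

## References

* [BrezinaFeireisl2018] J. Březina, E. Feireisl, *Measure-valued solutions to the complete Euler
  system*, J. Math. Soc. Japan 70 (2018) 1227–1245: Def. 2.9 ((2.20)–(2.24); arXiv (2.25)–(2.29)),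
  thermodynamic stability (2.19) (arXiv (2.24)), growth (3.1), class (3.2), Thm. 3.3 p. 1243.
  arXiv:1702.04870 (read).
* Ledger: wi-05002 (cite item), p4170 (bounced first attempt) and its review by rev-pool-g21-2.
-/

noncomputable section

open MeasureTheory ProbabilityTheory Set
open scoped ENNReal

namespace Literature.Analysis.FluidPDE

namespace CompressibleEuler

open EulerPhase

/-! ## Classical solutions of the complete Euler system for a general equation of state -/

/-- **Classical solution of the complete Euler system (1.1)–(1.3) on `[0,T) × 𝕋³`** for the
equation of state `eos` (pressure `eos.p ρ ϑ`, specific internal energy `eos.e ρ ϑ`): `ρ, u, ϑ`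
jointly smooth on `[0,T) × 𝕋³` (`Torus.IsSmoothSpaceTimeOn (Ico 0 T)`), `ρ, ϑ > 0`, and pointwise
on `[0,T) × 𝕋³` (one-sided time derivative within `[0,T)`):
`∂ₜρ + div(ρu) = 0`, `∂ₜ(ρu) + ∑ᵢ ∂ᵢ(ρ uᵢ u) + ∇p(ρ,ϑ) = 0`,
`∂ₜE + div((E + p)u) = 0` with `E = ρ(|u|²/2 + e(ρ,ϑ))` — the same shape, field for field, as
`Literature.MathematicalPhysics.KineticTheory.IsHardSphereEulerSolution` (which is the case
`p = hsPressure σ`, `e = 3ϑ/2`). [cite: BrezinaFeireisl2018, (1.1)–(1.3) and (3.2)] -/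
structure IsClassicalEulerSolution (eos : EulerEOS) (T : ℝ) (ρ : ℝ → UnitAddTorus (Fin 3) → ℝ)
    (u : ℝ → UnitAddTorus (Fin 3) → EuclideanSpace ℝ (Fin 3))
    (ϑ : ℝ → UnitAddTorus (Fin 3) → ℝ) : Prop where
  smooth_density : Literature.Analysis.FunctionSpaces.Torus.IsSmoothSpaceTimeOn (Ico 0 T) ρ
  smooth_velocity : Literature.Analysis.FunctionSpaces.Torus.IsSmoothSpaceTimeOn (Ico 0 T) u
  smooth_temperature : Literature.Analysis.FunctionSpaces.Torus.IsSmoothSpaceTimeOn (Ico 0 T) ϑ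
  density_pos : ∀ t ∈ Ico 0 T, ∀ x, 0 < ρ t x
  temperature_pos : ∀ t ∈ Ico 0 T, ∀ x, 0 < ϑ t x
  mass : ∀ t ∈ Ico 0 T, ∀ x,
    Literature.Analysis.FunctionSpaces.Torus.timeDerivWithin (Ico 0 T) ρ t x +
      Literature.Analysis.FunctionSpaces.Torus.divergence (fun y => ρ t y • u t y) x = 0
  momentum : ∀ t ∈ Ico 0 T, ∀ x,
    Literature.Analysis.FunctionSpaces.Torus.timeDerivWithin (Ico 0 T) (fun s y => ρ s y • u s y) t x +
      (∑ i, Literature.Analysis.FunctionSpaces.Torus.partialDeriv i (fun y => (ρ t y * u t y i) • u t y) x) +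
      Literature.Analysis.FunctionSpaces.Torus.gradient (fun y => eos.p (ρ t y) (ϑ t y)) x = 0
  energy : ∀ t ∈ Ico 0 T, ∀ x,
    Literature.Analysis.FunctionSpaces.Torus.timeDerivWithin (Ico 0 T)
        (fun s y => ρ s y * (‖u s y‖ ^ 2 / 2 + eos.e (ρ s y) (ϑ s y))) t x +
      Literature.Analysis.FunctionSpaces.Torus.divergence (fun y =>
        (ρ t y * (‖u t y‖ ^ 2 / 2 + eos.e (ρ t y) (ϑ t y)) + eos.p (ρ t y) (ϑ t y)) • u t y) x = 0

/-- The conservative state `[ρ, ρ e(ρ,ϑ), ρ u]` of the classical fields at `(t, x)` — the point of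
the phase space `F` at which BF's Dirac Young measure sits. [cite: BrezinaFeireisl2018, Thm. 3.3] -/
def classicalState (eos : EulerEOS) (ρ : ℝ → UnitAddTorus (Fin 3) → ℝ)
    (u : ℝ → UnitAddTorus (Fin 3) → EuclideanSpace ℝ (Fin 3)) (ϑ : ℝ → UnitAddTorus (Fin 3) → ℝ)
    (t : ℝ) (x : UnitAddTorus (Fin 3)) : EulerPhase :=
  (ρ t x, ρ t x * eos.e (ρ t x) (ϑ t x), ρ t x • u t x)

/-! ## The named fact -/

/-- NAMED FACT — **Březina–Feireisl 2018, Thm. 3.3 (weak (measure-valued)–strong uniqueness for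
the complete Euler system)**, in the repaired form (b) of the review of p4170 (see the module
docstring for the printed text and the five points in which this rendering is WEAKER than print).
For an equation of state `eos` with Gibbs' relation (1.5) (`IsGibbs`), thermodynamic stability
(2.19) (`IsThermodynamicallyStable`), `C²` constitutive functions and `e > 0` on the open quadrant,
a temperature inversion that is a genuine inverse there, and the pressure growth (3.1)
`|p| ≤ c(1 + ρ + ρ|s| + ρe)`: if `(ρ, u, ϑ)` is a classical solution on `[0,T₁)` with `T < T₁`,
and `(Y, D)` is a dissipative measure-valued solution on `(0,T)` (BF Def. 2.9,
`IsDissipativeMVSolution eos.toConservative T Y D`) whose Young measure is carried by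
`{ρ > 0, E > 0}` and whose initial slice is `Y (0,x) = δ_{[ρ₀, ρ₀e(ρ₀,ϑ₀), ρ₀u₀](x)}` for a.e. `x`,
then `D = 0` a.e. on `(0,T)` and `Y (t,x) = δ_{[ρ, ρe(ρ,ϑ), ρu](t,x)}` for a.e.
`(t,x) ∈ (0,T) × 𝕋³`. Users take `(h : brezinaFeireisl2018_thm_3_3)`. Grounds (as the engine of
step (iv) of its intended proof) `Summit.AtomisticToContinuum.HydrodynamicLimit.Theses.JParityClosure.ParityInBand`
and the weak–strong cruxes that cite wi-05002. [cite: BrezinaFeireisl2018, Thm. 3.3] -/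
def brezinaFeireisl2018_thm_3_3 : Prop :=
  ∀ (eos : EulerEOS), eos.IsGibbs → eos.IsThermodynamicallyStable →
    ContDiffOn ℝ 2 (Function.uncurry eos.p) (Ioi 0 ×ˢ Ioi 0) →
    ContDiffOn ℝ 2 (Function.uncurry eos.e) (Ioi 0 ×ˢ Ioi 0) →
    ContDiffOn ℝ 2 (Function.uncurry eos.s) (Ioi 0 ×ˢ Ioi 0) →
    (∀ r θ : ℝ, 0 < r → 0 < θ → 0 < eos.e r θ) →
    (∀ r E : ℝ, 0 < r → 0 < E → 0 < eos.temperature r E ∧ r * eos.e r (eos.temperature r E) = E) →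
    (∃ c : ℝ, ∀ r θ : ℝ, 0 < r → 0 < θ →
      |eos.p r θ| ≤ c * (1 + r + r * |eos.s r θ| + r * eos.e r θ)) →
    ∀ (T T₁ : ℝ), 0 < T → T < T₁ →
    ∀ (ρ : ℝ → UnitAddTorus (Fin 3) → ℝ) (u : ℝ → UnitAddTorus (Fin 3) → EuclideanSpace ℝ (Fin 3))
      (ϑ : ℝ → UnitAddTorus (Fin 3) → ℝ), IsClassicalEulerSolution eos T₁ ρ u ϑ →
    ∀ (Y : Kernel (ℝ × UnitAddTorus (Fin 3)) EulerPhase) (D : ℝ → ℝ),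
      IsDissipativeMVSolution eos.toConservative T Y D →
      (∀ z, ∀ᵐ w ∂(Y z), 0 < dens w ∧ 0 < ien w) →
      (∀ᵐ x ∂(volume : Measure (UnitAddTorus (Fin 3))),
        Y (0, x) = Measure.dirac (classicalState eos ρ u ϑ 0 x)) →
      (∀ᵐ τ ∂(volume.restrict (Ioo 0 T)), D τ = 0) ∧
        ∀ᵐ z ∂((volume.restrict (Ioo 0 T)).prod (volume : Measure (UnitAddTorus (Fin 3)))),
          Y z = Measure.dirac (classicalState eos ρ u ϑ z.1 z.2)

end CompressibleEuler

end Literature.Analysis.FluidPDE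

end
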